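import Mathlib.Algebra.Lie.OfAssociative
import Mathlib.Algebra.Module.LinearMap.End
import Mathlib.Algebra.BigOperators.Group.Finset.Basic
import Mathlib.Tactic.NoncommRing
import Literature.GroupTheory.CombinatorialGroupTheory.LowerCentralSeriesLieRing
import HarnessLib

/-!
# Magnus' method: unit representations in filtered rings and the Lie ring of the lower central series

Topic `Literature/GroupTheory/CombinatorialGroupTheory`. The classical mechanism behind Magnus'
treatment of the lower central series (Magnus 1937; Magnus–Karrass–Solitar, *Combinatorial Group
Theory*, §5.5–5.7; Serre, *Lie algebras and Lie groups*, Part I Ch. II and IV.6; used by Labute,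
J. Algebra 14 (1970) §3): let `A` be a ring with a descending filtration by additive subgroups
`E₀ ⊇ E₁ ⊇ E₂ ⊇ ⋯`, `E_m · E_n ⊆ E_{m+n}` (`IsDescFiltration`), and let `ρ : G →* Aˣ` be a
representation of a group by units with `ρ(g) ≡ 1 (mod E₁)`. Then

* `magnus_sub_one_mem` : `x ∈ γ_n(G)` ⟹ `ρ(x) - 1 ∈ E_{n+1}` (Mathlib numbering `γ₀ = G`);
* `magnus_mul_sub_mem` : on `γ_n`, `ρ(xy) - 1 ≡ (ρ x - 1) + (ρ y - 1) (mod E_{n+2})`;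
* `magnus_commutator_sub_mem` : for `x ∈ γ_m`, `y ∈ γ_n`,
  `ρ⁅x, y⁆ - 1 ≡ (ρ x - 1)(ρ y - 1) - (ρ y - 1)(ρ x - 1) (mod E_{m+n+3})`;
* `magnusLieHom` : consequently any family of additive "leading term" maps `ld_k : A → 𝔄` into a
  Lie ring, vanishing on `E_{k+1}` and turning products of filtration-`j`, `k` elements into
  brackets (`IsLeadingTerm`), yields a **morphism of Lie rings `gr(G) → 𝔄`**,
  `toGr n x ↦ ld_{n+1}(ρ x - 1)` (`magnusLieHom_toGr`), where `gr(G)` is the Lie ring of the lower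
  central series (`Literature/GroupTheory/CombinatorialGroupTheory/LowerCentralSeriesLieRing.lean`).

The second part supplies the standard instance of this formalism used for Labute's theorem: a
module `M` with a **finite grading** given by commuting orthogonal idempotents `π₀, …, π_N` summing
to `1` (`FiniteGrading`), the filtration `M_{≥ i}`, the induced descending filtration
`Fil_k = {T | T(M_{≥ i}) ⊆ M_{≥ i+k}}` of `End_R(M)` (`FiniteGrading.fil`, an `IsDescFiltration`), and
the **leading-term maps** `lead_k T = ∑ᵢ π_{i+k} T πᵢ` (`FiniteGrading.lead`): `lead_k` kills
`Fil_{k+1}`, is multiplicative on leading terms (`lead_mul`), fixes homogeneous operators of degree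
`k` (`lead_eq_self`), whence `FiniteGrading.isLeadingTerm` for the commutator Lie ring `End_R(M)`.

Everything here is folklore and fully proved; there are no named facts.

## References

* W. Magnus, A. Karrass, D. Solitar, *Combinatorial Group Theory*, 2nd ed., Dover 1976, §5.5–5.7.
* J.-P. Serre, *Lie algebras and Lie groups*, LNM 1500, Part I, Ch. II §3 and Ch. IV §6.
* J. P. Labute, J. Algebra 14 (1970) 16–23, §3. [Labute1970]
-/

namespace Literature.GroupTheory.CombinatorialGroupTheory

open scoped commutatorElement

-- Mathlib idiom: the commutator bracket on an associative ring (here on `A`, `End_R(M)`).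
attribute [local instance 100] LieRing.ofAssociativeRing

/-! ## Descending ring filtrations and unit representations congruent to `1` -/

section Magnus

variable {A : Type*} [Ring A]

/-- A **descending ring filtration** by additive subgroups: `E` is antitone and
`E_m · E_n ⊆ E_{m+n}`. [folklore] -/
structure IsDescFiltration (E : ℕ → AddSubgroup A) : Prop where
  /-- `E_{n} ⊆ E_m` for `m ≤ n`. -/
  antitone : Antitone E
  /-- `E_m · E_n ⊆ E_{m+n}`. -/
  mul_mem : ∀ {m n : ℕ} {a b : A}, a ∈ E m → b ∈ E n → a * b ∈ E (m + n)

namespace IsDescFiltration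

variable {E : ℕ → AddSubgroup A} (hE : IsDescFiltration E)
include hE

/-- Moving down the filtration. [folklore] -/
theorem mem_of_le {m n : ℕ} (h : m ≤ n) {a : A} (ha : a ∈ E n) : a ∈ E m := hE.antitone h ha

/-- `a ∈ E_k`, `c ∈ E_1` ⟹ `a (1 + c) ∈ E_k`. [folklore] -/
theorem mul_one_add_mem {k : ℕ} {a c : A} (ha : a ∈ E k) (hc : c ∈ E 1) : a * (1 + c) ∈ E k := by
  rw [mul_add, mul_one]
  exact add_mem ha (hE.mem_of_le (Nat.le_succ k) (hE.mul_mem ha hc))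

/-- The ring commutator `a b - b a` of `a ∈ E_m`, `b ∈ E_n` lies in `E_{m+n}`. [folklore] -/
theorem commutator_mem {m n : ℕ} {a b : A} (ha : a ∈ E m) (hb : b ∈ E n) : a * b - b * a ∈ E (m + n) :=
  sub_mem (hE.mul_mem ha hb) (by rw [add_comm]; exact hE.mul_mem hb ha)

end IsDescFiltration

/-- The key identity: for units `u, v`,
`u v u⁻¹ v⁻¹ - 1 = ((u-1)(v-1) - (v-1)(u-1)) · (u⁻¹ v⁻¹)`. [folklore] -/
theorem units_commutator_sub_one (u v : Aˣ) :
    ((u * v * u⁻¹ * v⁻¹ : Aˣ) : A) - 1 =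
      (((u : A) - 1) * ((v : A) - 1) - ((v : A) - 1) * ((u : A) - 1)) * ((u⁻¹ * v⁻¹ : Aˣ) : A) := by
  have h1 : ((u : A) - 1) * ((v : A) - 1) - ((v : A) - 1) * ((u : A) - 1) = u * v - v * u := by
    noncomm_ring
  rw [h1, sub_mul]
  have h2 : (v : A) * u * ((u⁻¹ * v⁻¹ : Aˣ) : A) = 1 := by
    rw [Units.val_mul, mul_assoc, ← mul_assoc (u : A), Units.mul_inv, one_mul, Units.mul_inv]
  rw [h2]
  simp only [Units.val_mul, mul_assoc]

/-- For a unit `u`, `u⁻¹ - 1 = -(u - 1) u⁻¹`. [folklore] -/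
theorem units_inv_sub_one (u : Aˣ) : ((u⁻¹ : Aˣ) : A) - 1 = -(((u : A) - 1) * ((u⁻¹ : Aˣ) : A)) := by
  rw [sub_mul, Units.mul_inv, one_mul, neg_sub]

/-- `u v - 1 = (u - 1) + (v - 1) + (u - 1)(v - 1)`. [folklore] -/
theorem mul_sub_one_eq (u v : A) : u * v - 1 = (u - 1) + (v - 1) + (u - 1) * (v - 1) := by
  noncomm_ring

variable {G : Type*} [Group G] {E : ℕ → AddSubgroup A}

/-- **Magnus' lemma.** If `ρ : G →* Aˣ` satisfies `ρ(g) ≡ 1 (mod E₁)` for all `g`, then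
`ρ(x) ≡ 1 (mod E_{n+1})` for `x ∈ γ_n(G)` (Mathlib numbering, `γ₀ = G`).
(Magnus–Karrass–Solitar §5.7; Serre LALG IV.6.) [folklore] -/
theorem magnus_sub_one_mem (hE : IsDescFiltration E) (ρ : G →* Aˣ) (hρ : ∀ g, (ρ g : A) - 1 ∈ E 1) :
    ∀ n, ∀ x ∈ lcs G n, (ρ x : A) - 1 ∈ E (n + 1) := by
  intro n
  induction n with
  | zero => intro x _; exact hρ x
  | succ n ih =>
    intro x hx
    change x ∈ ⁅lcs G n, (⊤ : Subgroup G)⁆ at hx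
    rw [Subgroup.commutator_def] at hx
    refine Subgroup.closure_induction (p := fun x _ => (ρ x : A) - 1 ∈ E (n + 1 + 1)) ?_ ?_ ?_ ?_ hx
    · rintro _ ⟨p, hp, q, -, rfl⟩
      rw [map_commutatorElement, commutatorElement_def, units_commutator_sub_one]
      have hc : (((ρ p)⁻¹ * (ρ q)⁻¹ : Aˣ) : A) = 1 + ((ρ (p⁻¹ * q⁻¹) : A) - 1) := by
        rw [map_mul, map_inv, map_inv]; abel
      rw [hc]
      refine hE.mul_one_add_mem ?_ (hρ _)
      have := hE.commutator_mem (ih p hp) (hρ q)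
      exact this
    · rw [map_one, Units.val_one, sub_self]; exact zero_mem _
    · intro x y _ _ hx hy
      rw [map_mul, Units.val_mul, mul_sub_one_eq]
      exact add_mem (add_mem hx hy) (hE.mem_of_le (by omega) (hE.mul_mem hx hy))
    · intro x _ hx
      rw [map_inv, units_inv_sub_one]
      refine neg_mem ?_
      have hc : (((ρ x)⁻¹ : Aˣ) : A) = 1 + ((ρ x⁻¹ : A) - 1) := by rw [map_inv]; abel
      rw [hc]
      exact hE.mul_one_add_mem hx (hρ _)

/-- **Additivity of leading terms**: for `x, y ∈ γ_n`,
`ρ(xy) - 1 - ((ρ x - 1) + (ρ y - 1)) ∈ E_{n+2}`. [folklore] -/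
theorem magnus_mul_sub_mem (hE : IsDescFiltration E) (ρ : G →* Aˣ) (hρ : ∀ g, (ρ g : A) - 1 ∈ E 1)
    {n : ℕ} {x y : G} (hx : x ∈ lcs G n) (hy : y ∈ lcs G n) :
    (ρ (x * y) : A) - 1 - (((ρ x : A) - 1) + ((ρ y : A) - 1)) ∈ E (n + 2) := by
  rw [map_mul, Units.val_mul, mul_sub_one_eq, add_sub_cancel_left]
  exact hE.mem_of_le (by omega)
    (hE.mul_mem (magnus_sub_one_mem hE ρ hρ n x hx) (magnus_sub_one_mem hE ρ hρ n y hy))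

/-- **Commutators become ring commutators**: for `x ∈ γ_m`, `y ∈ γ_n`,
`ρ⁅x,y⁆ - 1 - ((ρ x - 1)(ρ y - 1) - (ρ y - 1)(ρ x - 1)) ∈ E_{m+n+3}`. [folklore] -/
theorem magnus_commutator_sub_mem (hE : IsDescFiltration E) (ρ : G →* Aˣ)
    (hρ : ∀ g, (ρ g : A) - 1 ∈ E 1) {m n : ℕ} {x y : G} (hx : x ∈ lcs G m) (hy : y ∈ lcs G n) :
    (ρ ⁅x, y⁆ : A) - 1 - (((ρ x : A) - 1) * ((ρ y : A) - 1) - ((ρ y : A) - 1) * ((ρ x : A) - 1)) ∈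
      E (m + n + 3) := by
  rw [map_commutatorElement, commutatorElement_def, units_commutator_sub_one]
  have hc : (((ρ x)⁻¹ * (ρ y)⁻¹ : Aˣ) : A) = 1 + ((ρ (x⁻¹ * y⁻¹) : A) - 1) := by
    rw [map_mul, map_inv, map_inv]; abel
  rw [hc, mul_add, mul_one, add_sub_cancel_left]
  have h1 := hE.commutator_mem (magnus_sub_one_mem hE ρ hρ m x hx) (magnus_sub_one_mem hE ρ hρ n y hy)
  have := hE.mul_mem h1 (hρ (x⁻¹ * y⁻¹))
  rwa [show m + 1 + (n + 1) + 1 = m + n + 3 by omega] at this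

/-! ### From leading terms to a morphism of Lie rings `gr(G) → 𝔄` -/

variable {𝔄 : Type*} [LieRing 𝔄]

/-- **Leading-term data** for a descending filtration: additive maps `ld_k : A → 𝔄` into a Lie ring
such that `ld_k` vanishes on `E_{k+1}` and `⁅ld_j a, ld_k b⁆ = ld_{j+k}(ab - ba)` for `a ∈ E_j`,
`b ∈ E_k` (e.g. the symbol maps into the associated graded ring). [folklore] -/
structure IsLeadingTerm (E : ℕ → AddSubgroup A) (ld : ℕ → A →+ 𝔄) : Prop where
  /-- `ld_k` kills `E_{k+1}`. -/
  eq_zero : ∀ (k : ℕ) (a : A), a ∈ E (k + 1) → ld k a = 0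
  /-- leading terms multiply: `⁅ld_j a, ld_k b⁆ = ld_{j+k} (ab - ba)`. -/
  lie : ∀ (j k : ℕ) (a b : A), a ∈ E j → b ∈ E k → ⁅ld j a, ld k b⁆ = ld (j + k) (a * b - b * a)

/-- Leading terms of congruent elements agree. [folklore] -/
theorem IsLeadingTerm.eq_of_sub_mem {ld : ℕ → A →+ 𝔄} (hld : IsLeadingTerm E ld) {k : ℕ} {a b : A}
    (h : a - b ∈ E (k + 1)) : ld k a = ld k b := by
  rw [← sub_eq_zero, ← map_sub]; exact hld.eq_zero k _ h

/-- **The Lie ring morphism `gr(G) → 𝔄` attached to a unit representation congruent to `1` and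
leading-term data**: `toGr n x ↦ ld_{n+1}(ρ x - 1)`. (Magnus; Labute 1970 §3 uses the instance
`A = ℤ[G]` filtered by powers of the augmentation ideal.) [folklore] -/
noncomputable def magnusLieHom (hE : IsDescFiltration E) (ρ : G →* Aˣ) (hρ : ∀ g, (ρ g : A) - 1 ∈ E 1)
    (ld : ℕ → A →+ 𝔄) (hld : IsLeadingTerm E ld) : GrLCS G →ₗ⁅ℤ⁆ 𝔄 :=
  GrLCS.liftLie (fun n x => ld (n + 1) ((ρ x : A) - 1))
    (fun n x hx y hy => by
      rw [← map_add]
      exact hld.eq_of_sub_mem (magnus_mul_sub_mem hE ρ hρ hx hy))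
    (fun n x hx => hld.eq_zero _ _ (magnus_sub_one_mem hE ρ hρ (n + 1) x hx))
    (fun m n x hx y hy => by
      rw [hld.lie _ _ _ _ (magnus_sub_one_mem hE ρ hρ m x hx) (magnus_sub_one_mem hE ρ hρ n y hy),
        show m + 1 + (n + 1) = m + n + 1 + 1 by omega]
      exact hld.eq_of_sub_mem (magnus_commutator_sub_mem hE ρ hρ hx hy))

/-- `magnusLieHom` on symbols: `toGr n x ↦ ld_{n+1}(ρ x - 1)` for `x ∈ γ_n`. [folklore] -/
@[simp] theorem magnusLieHom_toGr (hE : IsDescFiltration E) (ρ : G →* Aˣ) (hρ : ∀ g, (ρ g : A) - 1 ∈ E 1)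
    (ld : ℕ → A →+ 𝔄) (hld : IsLeadingTerm E ld) {n : ℕ} {x : G} (hx : x ∈ lcs G n) :
    magnusLieHom hE ρ hρ ld hld (toGr G n x) = ld (n + 1) ((ρ x : A) - 1) :=
  GrLCS.liftLie_toGr _ _ _ _ hx

end Magnus

/-! ## Finitely graded modules: the filtration of `End(M)` and leading terms of endomorphisms -/

section Graded

variable {R : Type*} [CommRing R] {M : Type*} [AddCommGroup M] [Module R M]

variable (R M) in
/-- A **finite grading** of a module by orthogonal idempotent projections `π₀, …, π_N` with
`∑ πᵢ = 1` (so `M = ⊕_{i ≤ N} πᵢ M`). [folklore] -/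
structure FiniteGrading where
  /-- the top degree `N` -/
  bound : ℕ
  /-- the projections `πᵢ` (zero for `i > N`) -/
  proj : ℕ → Module.End R M
  /-- orthogonal idempotents -/
  proj_mul_proj : ∀ i j, proj i * proj j = if i = j then proj i else 0
  /-- no degrees above the bound -/
  proj_eq_zero_of_lt : ∀ i, bound < i → proj i = 0
  /-- completeness -/
  sum_proj : ∑ i ∈ Finset.range (bound + 1), proj i = 1

namespace FiniteGrading

variable (Γ : FiniteGrading R M)

/-- `πᵢ πᵢ = πᵢ`. [folklore] -/
theorem proj_idem (i : ℕ) (x : M) : Γ.proj i (Γ.proj i x) = Γ.proj i x := by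
  have := Γ.proj_mul_proj i i
  rw [if_pos rfl] at this
  exact LinearMap.congr_fun this x

/-- `πⱼ πᵢ = 0` for `j ≠ i`. [folklore] -/
theorem proj_proj_of_ne {i j : ℕ} (h : j ≠ i) (x : M) : Γ.proj j (Γ.proj i x) = 0 := by
  have := Γ.proj_mul_proj j i
  rw [if_neg h] at this
  exact LinearMap.congr_fun this x

/-- `x = ∑_{i ≤ N} πᵢ x`. [folklore] -/
theorem sum_proj_apply (x : M) : ∑ i ∈ Finset.range (Γ.bound + 1), Γ.proj i x = x := by
  have := LinearMap.congr_fun Γ.sum_proj x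
  rwa [LinearMap.sum_apply] at this

/-- The **filtration piece `M_{≥ i}`**: elements with no components in degrees `< i`. [folklore] -/
def ge (i : ℕ) : Submodule R M where
  carrier := {x | ∀ j < i, Γ.proj j x = 0}
  zero_mem' := fun j _ => map_zero _
  add_mem' := fun {x y} hx hy j hj => by rw [map_add, hx j hj, hy j hj, add_zero]
  smul_mem' := fun c x hx j hj => by rw [map_smul, hx j hj, smul_zero]

/-- Membership in `M_{≥ i}`. [folklore] -/
theorem mem_ge_iff {i : ℕ} {x : M} : x ∈ Γ.ge i ↔ ∀ j < i, Γ.proj j x = 0 := Iff.rfl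

/-- `M_{≥ i}` decreases with `i`. [folklore] -/
theorem ge_antitone {i i' : ℕ} (h : i ≤ i') : Γ.ge i' ≤ Γ.ge i :=
  fun _ hx j hj => hx j (lt_of_lt_of_le hj h)

/-- `πᵢ M ⊆ M_{≥ i}`. [folklore] -/
theorem proj_mem_ge (i : ℕ) (x : M) : Γ.proj i x ∈ Γ.ge i :=
  fun _ hj => Γ.proj_proj_of_ne (ne_of_lt hj) x

/-- `M_{≥ i} = 0` for `i > N`. [folklore] -/
theorem eq_zero_of_mem_ge {i : ℕ} (hi : Γ.bound < i) {x : M} (hx : x ∈ Γ.ge i) : x = 0 := by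
  rw [← Γ.sum_proj_apply x]
  exact Finset.sum_eq_zero fun j hj => hx j (lt_of_le_of_lt (Nat.lt_succ_iff.1 (Finset.mem_range.1 hj)) hi)

/-- Removing the leading component moves one step up the filtration:
`x ∈ M_{≥ i}` ⟹ `x - πᵢ x ∈ M_{≥ i+1}`. [folklore] -/
theorem sub_proj_mem_ge_succ {i : ℕ} {x : M} (hx : x ∈ Γ.ge i) : x - Γ.proj i x ∈ Γ.ge (i + 1) := by
  intro j hj
  rw [map_sub]
  rcases Nat.lt_succ_iff_lt_or_eq.1 hj with hj | rfl
  · rw [hx j hj, Γ.proj_proj_of_ne (ne_of_lt hj), sub_zero]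
  · rw [Γ.proj_idem, sub_self]

/-- The component of degree `i` of an element of `M_{≥ i+1}` vanishes. [folklore] -/
theorem proj_eq_zero_of_mem_ge_succ {i : ℕ} {x : M} (hx : x ∈ Γ.ge (i + 1)) : Γ.proj i x = 0 :=
  hx i (Nat.lt_succ_self i)

/-- The **descending filtration of `End(M)`**: `Fil_k = {T | T(M_{≥ i}) ⊆ M_{≥ i+k} for all i}`.
[folklore] -/
def fil (k : ℕ) : Submodule R (Module.End R M) where
  carrier := {T | ∀ i, ∀ x ∈ Γ.ge i, T x ∈ Γ.ge (i + k)}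
  zero_mem' := fun i x _ => by rw [LinearMap.zero_apply]; exact Submodule.zero_mem _
  add_mem' := fun {S T} hS hT i x hx => by rw [LinearMap.add_apply]; exact add_mem (hS i x hx) (hT i x hx)
  smul_mem' := fun c T hT i x hx => by rw [LinearMap.smul_apply]; exact Submodule.smul_mem _ c (hT i x hx)

/-- Membership in `Fil_k`. [folklore] -/
theorem mem_fil_iff {k : ℕ} {T : Module.End R M} : T ∈ Γ.fil k ↔ ∀ i, ∀ x ∈ Γ.ge i, T x ∈ Γ.ge (i + k) :=
  Iff.rfl

/-- `Fil` decreases. [folklore] -/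
theorem fil_antitone : Antitone fun k => (Γ.fil k).toAddSubgroup :=
  fun k l hkl T hT i x hx => Γ.ge_antitone (by simpa using hkl) (hT i x hx)

/-- `Fil_k · Fil_l ⊆ Fil_{k+l}` (composition of endomorphisms). [folklore] -/
theorem mul_mem_fil {k l : ℕ} {S T : Module.End R M} (hS : S ∈ Γ.fil k) (hT : T ∈ Γ.fil l) :
    S * T ∈ Γ.fil (k + l) := by
  intro i x hx
  rw [Module.End.mul_apply]
  have := hS (i + l) (T x) (hT i x hx)
  rwa [add_assoc, add_comm l] at this

/-- `1 ∈ Fil_0`. [folklore] -/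
theorem one_mem_fil_zero : (1 : Module.End R M) ∈ Γ.fil 0 := fun i x hx => by simpa using hx

/-- `Fil` is a descending ring filtration of `End(M)`. [folklore] -/
theorem isDescFiltration : IsDescFiltration fun k => (Γ.fil k).toAddSubgroup :=
  ⟨Γ.fil_antitone, fun hS hT => Γ.mul_mem_fil hS hT⟩

/-- A criterion for `T ∈ Fil_k`: it suffices to test homogeneous elements, `T(πᵢ x) ∈ M_{≥ i+k}`.
[folklore] -/
theorem mem_fil_of_apply_proj {k : ℕ} {T : Module.End R M} (h : ∀ i x, T (Γ.proj i x) ∈ Γ.ge (i + k)) :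
    T ∈ Γ.fil k := by
  intro i x hx
  rw [← Γ.sum_proj_apply x, map_sum]
  refine Submodule.sum_mem _ fun j _ => ?_
  by_cases hji : j < i
  · rw [hx j hji, map_zero]; exact Submodule.zero_mem _
  · exact Γ.ge_antitone (by omega) (h j x)

/-- **Homogeneous operators of degree `k`**: `T` maps `πᵢ M` into `π_{i+k} M` for all `i`.
[folklore] -/
def IsHomogeneous (k : ℕ) (T : Module.End R M) : Prop :=
  ∀ i x, Γ.proj (i + k) (T (Γ.proj i x)) = T (Γ.proj i x)

/-- A homogeneous operator of degree `k` lies in `Fil_k`. [folklore] -/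
theorem IsHomogeneous.mem_fil {k : ℕ} {T : Module.End R M} (hT : Γ.IsHomogeneous k T) : T ∈ Γ.fil k :=
  Γ.mem_fil_of_apply_proj fun i x => by rw [← hT i x]; exact Γ.proj_mem_ge _ _

/-- The **leading term of degree `k`** of an endomorphism: `lead_k T = ∑ᵢ π_{i+k} T πᵢ`.
[folklore] -/
def lead (k : ℕ) : Module.End R M →ₗ[R] Module.End R M where
  toFun T := ∑ i ∈ Finset.range (Γ.bound + 1), Γ.proj (i + k) * T * Γ.proj i
  map_add' S T := by
    rw [← Finset.sum_add_distrib]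
    refine Finset.sum_congr rfl fun i _ => ?_
    rw [mul_add, add_mul]
  map_smul' c T := by
    rw [Finset.smul_sum]
    refine Finset.sum_congr rfl fun i _ => ?_
    rw [RingHom.id_apply, mul_smul_comm, smul_mul_assoc]

/-- `lead_k T` applied to a vector. [folklore] -/
theorem lead_apply (k : ℕ) (T : Module.End R M) (x : M) :
    Γ.lead k T x = ∑ i ∈ Finset.range (Γ.bound + 1), Γ.proj (i + k) (T (Γ.proj i x)) := by
  change (∑ i ∈ Finset.range (Γ.bound + 1), Γ.proj (i + k) * T * Γ.proj i) x = _
  rw [LinearMap.sum_apply]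
  rfl

/-- `lead_k` kills `Fil_{k+1}`. [folklore] -/
theorem lead_eq_zero_of_mem_fil_succ {k : ℕ} {T : Module.End R M} (hT : T ∈ Γ.fil (k + 1)) :
    Γ.lead k T = 0 := by
  ext x
  rw [lead_apply, LinearMap.zero_apply]
  refine Finset.sum_eq_zero fun i _ => ?_
  have := hT i _ (Γ.proj_mem_ge i x)
  rw [← add_assoc] at this
  exact Γ.proj_eq_zero_of_mem_ge_succ this

/-- Leading terms of congruent operators agree. [folklore] -/
theorem lead_eq_of_sub_mem {k : ℕ} {S T : Module.End R M} (h : S - T ∈ Γ.fil (k + 1)) :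
    Γ.lead k S = Γ.lead k T := by
  rw [← sub_eq_zero, ← map_sub]; exact Γ.lead_eq_zero_of_mem_fil_succ h

/-- **`lead` is multiplicative on leading terms**: `lead_{k+l}(S T) = lead_k S ∘ lead_l T` for
`S ∈ Fil_k`, `T ∈ Fil_l`. [folklore] -/
theorem lead_mul {k l : ℕ} {S T : Module.End R M} (hS : S ∈ Γ.fil k) (hT : T ∈ Γ.fil l) :
    Γ.lead (k + l) (S * T) = Γ.lead k S * Γ.lead l T := by
  ext x
  rw [Module.End.mul_apply, lead_apply, lead_apply, lead_apply]
  simp only [map_sum]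
  rw [Finset.sum_comm]
  refine Finset.sum_congr rfl fun i _ => ?_
  -- only the term `i' = i + l` survives in `∑_{i'} π_{i'+k} S π_{i'} (π_{i+l} T πᵢ x)`
  have hsingle : ∑ i' ∈ Finset.range (Γ.bound + 1),
      Γ.proj (i' + k) (S (Γ.proj i' (Γ.proj (i + l) (T (Γ.proj i x))))) =
        Γ.proj (i + l + k) (S (Γ.proj (i + l) (T (Γ.proj i x)))) := by
    by_cases hil : i + l ≤ Γ.bound
    · rw [Finset.sum_eq_single (i + l)]
      · rw [Γ.proj_idem]
      · intro i' _ hi'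
        rw [Γ.proj_proj_of_ne hi', map_zero, map_zero]
      · intro h; exact absurd (Finset.mem_range.2 (Nat.lt_succ_of_le hil)) h
    · have hz : Γ.proj (i + l) = 0 := Γ.proj_eq_zero_of_lt _ (not_le.1 hil)
      simp [hz]
  rw [hsingle, Module.End.mul_apply]
  -- compare `π_{i+k+l} S (T πᵢ x)` with `π_{i+l+k} S π_{i+l} (T πᵢ x)`
  have hy : T (Γ.proj i x) ∈ Γ.ge (i + l) := hT i _ (Γ.proj_mem_ge i x)
  have hS' := hS (i + l + 1) _ (Γ.sub_proj_mem_ge_succ hy)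
  have hzero : Γ.proj (i + l + k) (S (T (Γ.proj i x) - Γ.proj (i + l) (T (Γ.proj i x)))) = 0 :=
    hS' _ (by omega)
  rw [map_sub, map_sub, sub_eq_zero] at hzero
  rw [show i + (k + l) = i + l + k by omega, hzero]

/-- A homogeneous operator of degree `k` is its own leading term. [folklore] -/
theorem lead_eq_self {k : ℕ} {T : Module.End R M} (hT : Γ.IsHomogeneous k T) : Γ.lead k T = T := by
  ext x
  rw [lead_apply]
  conv_rhs => rw [← Γ.sum_proj_apply x, map_sum]
  exact Finset.sum_congr rfl fun i _ => hT i x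

/-- The identity is homogeneous of degree `0`. [folklore] -/
theorem isHomogeneous_one : Γ.IsHomogeneous 0 (1 : Module.End R M) := fun i x => by
  rw [add_zero, Module.End.one_apply, Γ.proj_idem]

/-- `lead_0 1 = 1`. [folklore] -/
theorem lead_zero_one : Γ.lead 0 (1 : Module.End R M) = 1 := Γ.lead_eq_self Γ.isHomogeneous_one

/-- `lead_0 (1 + T) = 1` for `T ∈ Fil_1`. [folklore] -/
theorem lead_zero_one_add {T : Module.End R M} (hT : T ∈ Γ.fil 1) : Γ.lead 0 (1 + T) = 1 := by
  rw [map_add, lead_zero_one, Γ.lead_eq_zero_of_mem_fil_succ hT, add_zero]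

/-- `lead_k T ∈ Fil_k`: more precisely `lead_k T` is homogeneous of degree `k`. [folklore] -/
theorem isHomogeneous_lead (k : ℕ) (T : Module.End R M) : Γ.IsHomogeneous k (Γ.lead k T) := by
  intro i x
  rw [lead_apply, map_sum]
  refine Finset.sum_congr rfl fun j _ => ?_
  by_cases hji : j = i
  · subst hji; rw [Γ.proj_idem, Γ.proj_idem]
  · rw [Γ.proj_proj_of_ne hji, map_zero, map_zero, map_zero]

/-- **The leading-term maps of a finite grading satisfy `IsLeadingTerm`** for the filtration
`Fil` of `End(M)` and the commutator Lie ring `End(M)`. [folklore] -/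
theorem isLeadingTerm :
    IsLeadingTerm (fun k => (Γ.fil k).toAddSubgroup) fun k => (Γ.lead k).toAddMonoidHom := by
  refine ⟨fun k T hT => Γ.lead_eq_zero_of_mem_fil_succ hT, fun j k S T hS hT => ?_⟩
  change ⁅Γ.lead j S, Γ.lead k T⁆ = Γ.lead (j + k) (S * T - T * S)
  rw [LieRing.of_associative_ring_bracket, map_sub, Γ.lead_mul hS hT, add_comm j k, Γ.lead_mul hT hS]

end FiniteGrading

end Graded

end Literature.GroupTheory.CombinatorialGroupTheory
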